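import Literature.Computability.Cryptography.WordRAM
import HarnessLib

/-!
# The word RAM — an execution calculus (runs, step equations, segment lemmas)

Bookkeeping for reasoning about concrete word-RAM programs of
`Literature.Computability.Cryptography.WordRAM` (the layer that every verified program — the
one-query self-reduction of `FGReducible.refl`, the inline simulations of VVW ICM 2018
Props. 2.1–2.2, the zoo's `IsStandard`/`InTime` witnesses — is built on):

* `run P w O ρ n c`: the configuration after `n` steps from `c` (`none` once halted), i.e.
  `(flip bind (step P w O ρ))^[n] (some c)`, with `run_zero`, `run_succ`, `run_add`,
  `run_succ_of_step`; `haltsWithin_of_run` / `HaltsWithin.exists_run` convert between runs and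
  the time-bounded certificates `HaltsWithin` (Mathlib's `StateTransition.EvalsToInTime`);
* one `step_*` equation per instruction (`step_op`, `step_jmp`, `step_jz_zero`, `step_jz_ne`,
  `step_rand`, `step_query`, `step_halt`, `step_of_getElem?_eq_none`, `step_of_pc_eq_none`);
* segment lemmas: `writeSeg_apply_of_le` (cells past the segment), `writeSeg_apply_add`
  (cells inside), `readSeg_writeSeg` (reading back what was written), `readOut_answer`
  (the output convention after a `query … (imm 0)`), `readSeg_init` (the input segment of the
  initial memory is the input, when the word size is at least the input width).

## References

* T. Hagerup, *Sorting and searching on the word RAM*, STACS 1998, §2.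
* V. Vassilevska Williams, *On some fine-grained questions in algorithms and complexity*,
  Proc. ICM 2018, §2.
-/

namespace Literature.Computability.Cryptography.WordRAM

open StateTransition

/-! ## Runs -/

/-- The configuration reached after exactly `n` steps of `P` (word size `w`, oracle `O`, coins
`ρ`) from `c`, or `none` if the machine halted earlier: the `n`-th iterate of `flip bind step`
(the quantity bounded by `StateTransition.EvalsToInTime`). [folklore] -/
def run (P : Program) (w : ℕ) (O : List ℕ → List ℕ) (ρ : ℕ → ℕ) (n : ℕ) (c : Cfg) : Option Cfg :=
  (flip bind (step P w O ρ))^[n] (some c)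

section run

variable (P : Program) (w : ℕ) (O : List ℕ → List ℕ) (ρ : ℕ → ℕ)

/-- Zero steps. [folklore] -/
@[simp] theorem run_zero (c : Cfg) : run P w O ρ 0 c = some c := rfl

/-- Unfolding `run` as an iterate (the form appearing in `EvalsToInTime.evals_in_steps`). [folklore] -/
theorem run_eq_iterate (n : ℕ) (c : Cfg) :
    run P w O ρ n c = (flip bind (step P w O ρ))^[n] (some c) := rfl

/-- One more step, taken first. [folklore] -/
theorem run_succ (n : ℕ) (c : Cfg) :
    run P w O ρ (n + 1) c = (step P w O ρ c).bind fun c' => run P w O ρ n c' := by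
  unfold run
  rw [Function.iterate_succ_apply]
  show (flip bind (step P w O ρ))^[n] (step P w O ρ c) = _
  cases h : step P w O ρ c with
  | none => exact Function.iterate_fixed (f := flip bind (step P w O ρ)) (x := none) rfl n
  | some c' => rfl

/-- One more step from a configuration whose successor is known. [folklore] -/
theorem run_succ_of_step {c c' : Cfg} (h : step P w O ρ c = some c') (n : ℕ) :
    run P w O ρ (n + 1) c = run P w O ρ n c' := by
  rw [run_succ, h, Option.bind_some]

/-- A halted configuration stays halted: no configuration is reached after further steps. [folklore] -/
theorem run_succ_of_step_eq_none {c : Cfg} (h : step P w O ρ c = none) (n : ℕ) :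
    run P w O ρ (n + 1) c = none := by
  rw [run_succ, h, Option.bind_none]

/-- Runs compose: `m + n` steps are `m` steps followed by `n` steps. [folklore] -/
theorem run_add (m n : ℕ) (c : Cfg) :
    run P w O ρ (m + n) c = (run P w O ρ m c).bind fun c' => run P w O ρ n c' := by
  induction m generalizing c with
  | zero => simp
  | succ m ih =>
    rw [Nat.succ_add, run_succ, run_succ]
    cases h : step P w O ρ c with
    | none => rfl
    | some c' => simpa using ih c'

/-- Composition of two known run segments. [folklore] -/
theorem run_add_of_run {m n : ℕ} {c c' : Cfg} {r : Option Cfg} (h₁ : run P w O ρ m c = some c')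
    (h₂ : run P w O ρ n c' = r) : run P w O ρ (m + n) c = r := by
  rw [run_add, h₁, Option.bind_some, h₂]

/-- One step as a run. [folklore] -/
theorem run_one (c : Cfg) : run P w O ρ 1 c = step P w O ρ c := by
  rw [run_succ]; cases step P w O ρ c <;> rfl

end run

/-- **From a run to a certificate.** If `P` reaches `c` from the initial configuration in `n ≤ t`
steps and `c` is halted, then `HaltsWithin P w O ρ x t c`. [folklore] -/
theorem haltsWithin_of_run {P : Program} {w : ℕ} {O : List ℕ → List ℕ} {ρ : ℕ → ℕ} {x : List ℕ}
    {n t : ℕ} {c : Cfg} (h : run P w O ρ n (init w x) = some c) (hc : step P w O ρ c = none)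
    (hn : n ≤ t) : HaltsWithin P w O ρ x t c :=
  ⟨⟨⟨⟨n, h⟩, hn⟩⟩, hc⟩

/-- **From a certificate to a run.** [folklore] -/
theorem HaltsWithin.exists_run {P : Program} {w : ℕ} {O : List ℕ → List ℕ} {ρ : ℕ → ℕ}
    {x : List ℕ} {t : ℕ} {c : Cfg} (h : HaltsWithin P w O ρ x t c) :
    ∃ n, n ≤ t ∧ run P w O ρ n (init w x) = some c ∧ step P w O ρ c = none := by
  obtain ⟨⟨e⟩, hc⟩ := h
  exact ⟨e.steps, e.steps_le_m, e.evals_in_steps, hc⟩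

/-- `OutputsWithin` from a run. [folklore] -/
theorem outputsWithin_of_run {P : Program} {w : ℕ} {O : List ℕ → List ℕ} {ρ : ℕ → ℕ}
    {x : List ℕ} {n t : ℕ} {c : Cfg} (h : run P w O ρ n (init w x) = some c)
    (hc : step P w O ρ c = none) (hn : n ≤ t) : OutputsWithin P w O ρ x (readOut c.mem) t :=
  ⟨c, ⟨⟨⟨n, h⟩, hn⟩⟩, hc, rfl⟩

/-! ## Step equations -/

section step

variable {P : Program} {w : ℕ} {O : List ℕ → List ℕ} {ρ : ℕ → ℕ} {c : Cfg} {i : ℕ}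

/-- A halted configuration has no successor. [folklore] -/
theorem step_of_pc_eq_none (h : c.pc = none) : step P w O ρ c = none := by
  unfold step; rw [h]

/-- A program counter outside the program halts the machine. [folklore] -/
theorem step_of_getElem?_eq_none (hpc : c.pc = some i) (h : P[i]? = none) :
    step P w O ρ c = some { c with pc := none } := by
  unfold step; rw [hpc]; simp only [h]

/-- `halt` halts the machine. [folklore] -/
theorem step_halt (hpc : c.pc = some i) (h : P[i]? = some .halt) :
    step P w O ρ c = some { c with pc := none } := by
  unfold step; rw [hpc]; simp only [h]

/-- The three-address operation. [folklore] -/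
theorem step_op (hpc : c.pc = some i) {o : BinOp} {dst x y : Operand}
    (h : P[i]? = some (.op o dst x y)) :
    step P w O ρ c =
      some { c with pc := some (i + 1),
                    mem := dst.write c.mem (o.eval w (x.read c.mem) (y.read c.mem)) } := by
  unfold step; rw [hpc]; simp only [h]

/-- The unconditional jump. [folklore] -/
theorem step_jmp (hpc : c.pc = some i) {t : ℕ} (h : P[i]? = some (.jmp t)) :
    step P w O ρ c = some { c with pc := some t } := by
  unfold step; rw [hpc]; simp only [h]

/-- The conditional jump, general form. [folklore] -/
theorem step_jz (hpc : c.pc = some i) {x : Operand} {t : ℕ} (h : P[i]? = some (.jz x t)) :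
    step P w O ρ c =
      some { c with pc := if x.read c.mem = 0 then some t else some (i + 1) } := by
  unfold step; rw [hpc]; simp only [h]

/-- The conditional jump, taken. [folklore] -/
theorem step_jz_zero (hpc : c.pc = some i) {x : Operand} {t : ℕ} (h : P[i]? = some (.jz x t))
    (hx : x.read c.mem = 0) : step P w O ρ c = some { c with pc := some t } := by
  rw [step_jz hpc h, if_pos hx]

/-- The conditional jump, not taken. [folklore] -/
theorem step_jz_ne (hpc : c.pc = some i) {x : Operand} {t : ℕ} (h : P[i]? = some (.jz x t))
    (hx : x.read c.mem ≠ 0) : step P w O ρ c = some { c with pc := some (i + 1) } := by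
  rw [step_jz hpc h, if_neg hx]

/-- The random word. [folklore] -/
theorem step_rand (hpc : c.pc = some i) {dst : Operand} (h : P[i]? = some (.rand dst)) :
    step P w O ρ c =
      some { c with pc := some (i + 1), mem := dst.write c.mem (ρ c.coinPos % 2 ^ w),
                    coinPos := c.coinPos + 1 } := by
  unfold step; rw [hpc]; simp only [h]

/-- The oracle query. [folklore] -/
theorem step_query (hpc : c.pc = some i) {qa ql aa : Operand}
    (h : P[i]? = some (.query qa ql aa)) :
    step P w O ρ c =
      some { c with pc := some (i + 1),
                    mem := writeSeg (Function.update c.mem (aa.read c.mem)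
                              ((O (readSeg c.mem (qa.read c.mem) (ql.read c.mem))).map
                                (· % 2 ^ w)).length)
                            (aa.read c.mem + 1)
                            ((O (readSeg c.mem (qa.read c.mem) (ql.read c.mem))).map (· % 2 ^ w)),
                    queries := c.queries ++ [readSeg c.mem (qa.read c.mem) (ql.read c.mem)] } := by
  unfold step; rw [hpc]; simp only [h]

end step

/-! ## Segments -/

/-- Cells at or beyond the end of the written segment are untouched by `writeSeg`. [folklore] -/
theorem writeSeg_apply_of_le :
    ∀ (l : List ℕ) (mem : ℕ → ℕ) (a b : ℕ), a + l.length ≤ b → writeSeg mem a l b = mem b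
  | [], _, _, _, _ => rfl
  | v :: l, mem, a, b, hab => by
      rw [writeSeg_cons, writeSeg_apply_of_le l _ _ _ (by simp at hab; omega),
        Function.update_of_ne (by simp at hab; omega)]

/-- The `j`-th cell of the written segment holds `l[j]`. [folklore] -/
theorem writeSeg_apply_add :
    ∀ (l : List ℕ) (mem : ℕ → ℕ) (a j : ℕ) (hj : j < l.length), writeSeg mem a l (a + j) = l[j]
  | [], _, _, _, hj => by simp at hj
  | v :: l, mem, a, 0, _ => by
      show writeSeg (Function.update mem a v) (a + 1) l a = v
      rw [writeSeg_apply_of_lt _ _ _ _ (Nat.lt_succ_self a), Function.update_self]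
  | v :: l, mem, a, j + 1, hj => by
      rw [writeSeg_cons, List.getElem_cons_succ,
        ← writeSeg_apply_add l (Function.update mem a v) (a + 1) j (by simpa using hj)]
      congr 1
      omega

/-- `writeSeg` as a pointwise formula. [folklore] -/
theorem writeSeg_apply (l : List ℕ) (mem : ℕ → ℕ) (a b : ℕ) :
    writeSeg mem a l b = if h : a ≤ b ∧ b < a + l.length then l[b - a]'(by omega) else mem b := by
  split_ifs with h
  · obtain ⟨j, rfl⟩ := Nat.exists_eq_add_of_le h.1
    simp only [Nat.add_sub_cancel_left]
    exact writeSeg_apply_add l mem a j (by omega)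
  · rcases Nat.lt_or_ge b a with hb | hb
    · exact writeSeg_apply_of_lt mem a l b hb
    · exact writeSeg_apply_of_le l mem a b (by omega)

/-- Reading back a written segment. [folklore] -/
theorem readSeg_writeSeg (l : List ℕ) (mem : ℕ → ℕ) (a : ℕ) :
    readSeg (writeSeg mem a l) a l.length = l := by
  apply List.ext_getElem (by simp)
  intro j hj _
  simp only [readSeg, List.getElem_map, List.getElem_range]
  exact writeSeg_apply_add l mem a j (by simpa using hj)

/-- `readSeg` depends only on the cells it reads. [folklore] -/
theorem readSeg_congr {mem mem' : ℕ → ℕ} {a len : ℕ} (h : ∀ j, j < len → mem (a + j) = mem' (a + j)) :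
    readSeg mem a len = readSeg mem' a len := by
  apply List.ext_getElem (by simp)
  intro j hj _
  simp only [readSeg, List.getElem_map, List.getElem_range]
  exact h j (by simpa using hj)

/-- **The output convention after a query answered at address `0`.** Writing the answer length
at cell `0` and the answer from cell `1` on, then reading the output, returns the answer. [folklore] -/
theorem readOut_answer (mem : ℕ → ℕ) (ans : List ℕ) :
    readOut (writeSeg (Function.update mem 0 ans.length) 1 ans) = ans := by
  unfold readOut
  rw [writeSeg_apply_of_lt _ _ _ _ Nat.one_pos, Function.update_self]
  exact readSeg_writeSeg ans _ 1

/-- The input segment of the initial memory is the input reduced modulo `2 ^ w`. [folklore] -/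
theorem readSeg_init_eq_map (w : ℕ) (x : List ℕ) :
    readSeg (init w x).mem 1 x.length = x.map (· % 2 ^ w) := by
  apply List.ext_getElem (by simp)
  intro j hj _
  simp only [readSeg, List.getElem_map, List.getElem_range]
  rw [Nat.add_comm, init_mem_succ w x j (by simpa using hj)]

/-- Reduction modulo `2 ^ w` is the identity on a list of `w'`-bit words, `w' ≤ w`. [folklore] -/
theorem map_mod_two_pow_eq_self {x : List ℕ} {w : ℕ} (h : ∀ v ∈ x, v < 2 ^ w) :
    x.map (· % 2 ^ w) = x := by
  conv_rhs => rw [← List.map_id x]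
  exact List.map_congr_left fun v hv => Nat.mod_eq_of_lt (h v hv)

/-- When the word size is at least the input width (`w = k * inputWidth x`, `1 ≤ k`), the input
is stored exactly: cell `0` holds `|x|` and the input segment reads back as `x`. [folklore] -/
theorem init_mem_zero_of_inputWidth_le {w : ℕ} {x : List ℕ} (h : inputWidth x ≤ w) :
    (init w x).mem 0 = x.length := by
  rw [init_mem_zero]
  exact Nat.mod_eq_of_lt
    (lt_of_lt_of_le (length_lt_two_pow_inputWidth x) (Nat.pow_le_pow_right Nat.two_pos h))

/-- When the word size is at least the input width, the input segment of the initial memory is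
the input itself. [folklore] -/
theorem readSeg_init_of_inputWidth_le {w : ℕ} {x : List ℕ} (h : inputWidth x ≤ w) :
    readSeg (init w x).mem 1 x.length = x := by
  rw [readSeg_init_eq_map]
  exact map_mod_two_pow_eq_self fun v hv =>
    lt_of_lt_of_le (lt_two_pow_inputWidth_of_mem x v hv) (Nat.pow_le_pow_right Nat.two_pos h)

/-- `k * inputWidth x` is at least the input width for `1 ≤ k`. [folklore] -/
theorem inputWidth_le_mul {k : ℕ} (hk : 1 ≤ k) (x : List ℕ) : inputWidth x ≤ k * inputWidth x :=
  Nat.le_mul_of_pos_left _ hk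

/-! ## A first verified program: query the input, halt

The two-instruction program `[query (imm 1) (dir 0) (imm 0), halt]` asks the oracle about its
own input and returns the answer: the self-reduction behind `FGReducible.refl` (on inputs where
a query is affordable). -/

/-- The program "query the oracle on the whole input, write the answer as the output, halt". [folklore] -/
def queryInput : Program :=
  [.query (.imm 1) (.dir 0) (.imm 0), .halt]

/-- `queryInput` is deterministic. [folklore] -/
theorem queryInput_isDeterministic : queryInput.IsDeterministic := by
  decide

/-- **Semantics of `queryInput`.** At any word size `w ≥ inputWidth x`, on input `x` with oracle
`O`, `queryInput` halts after `2` steps in a configuration whose output is `O x` reduced modulo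
`2 ^ w` and whose query log is `[x]`. [folklore] -/
theorem queryInput_run {w : ℕ} {x : List ℕ} (h : inputWidth x ≤ w) (O : List ℕ → List ℕ)
    (ρ : ℕ → ℕ) :
    ∃ c : Cfg, run queryInput w O ρ 2 (init w x) = some c ∧ step queryInput w O ρ c = none ∧
      readOut c.mem = (O x).map (· % 2 ^ w) ∧ c.queries = [x] := by
  have hx : readSeg (init w x).mem 1 ((init w x).mem 0) = x := by
    rw [init_mem_zero_of_inputWidth_le h, readSeg_init_of_inputWidth_le h]
  set ans : List ℕ := (O x).map (· % 2 ^ w) with hans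
  let c1 : Cfg :=
    { pc := some 1, mem := writeSeg (Function.update (init w x).mem 0 ans.length) 1 ans,
      coinPos := 0, queries := [x] }
  have h1 : step queryInput w O ρ (init w x) = some c1 := by
    rw [step_query (i := 0) (init_pc w x) (by rfl)]
    simp only [Operand.read_imm, Operand.read_dir, hx, init_queries, List.nil_append,
      init_coinPos, Nat.zero_add]
    rfl
  let c2 : Cfg := { c1 with pc := none }
  have h2 : step queryInput w O ρ c1 = some c2 := step_halt (i := 1) rfl (by rfl)
  refine ⟨c2, ?_, step_of_pc_eq_none rfl, readOut_answer _ _, rfl⟩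
  rw [run_succ_of_step _ _ _ _ h1, run_one, h2]

/-- `queryInput` as a `HaltsWithin` certificate: for every `t ≥ 2` it halts within `t` steps with
output `(O x).map (· % 2 ^ w)` and query log `[x]`. [folklore] -/
theorem queryInput_haltsWithin {w : ℕ} {x : List ℕ} (h : inputWidth x ≤ w) (O : List ℕ → List ℕ)
    (ρ : ℕ → ℕ) {t : ℕ} (ht : 2 ≤ t) :
    ∃ c : Cfg, HaltsWithin queryInput w O ρ x t c ∧ readOut c.mem = (O x).map (· % 2 ^ w) ∧
      c.queries = [x] := by
  obtain ⟨c, hrun, hstep, hout, hq⟩ := queryInput_run h O ρ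
  exact ⟨c, haltsWithin_of_run hrun hstep ht, hout, hq⟩

end Literature.Computability.Cryptography.WordRAM
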